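import Mathlib.GroupTheory.FiniteAbelian.Duality
import Mathlib.RingTheory.RootsOfUnity.AlgebraicallyClosed
import Mathlib.Analysis.Complex.Polynomial.Basic
import HarnessLib

/-!
# Real characters of a finite abelian group: `|{χ : χ² = 1}| = |G[2]|`

Topic `NumberTheory/NumberFields` (characters of class groups), namespace
`Literature.NumberTheory.NumberFields`.  Everything here is PROVED (theorems only).

For a finite abelian group `G`, the characters `χ : G →* ℂˣ` with `χ² = 1` ("real characters")
are the characters trivial on the subgroup of squares `G²`, i.e. the dual of `G/G²`; by duality of
finite abelian groups (Mathlib `CommGroup.card_subgroupOrderIsoSubgroupMonoidHom`) they number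
`|G/G²|`, and `|G/G²| = |G[2]|` (the squaring map has kernel `G[2]` and image `G²`):

* `card_quotient_range_sq_eq_card_sq_eq_one` — `|G ⧸ G²| = |{g : g² = 1}|`;
* `card_monoidHom_mul_self_eq_one` — **`|{χ : G →* ℂˣ // χ·χ = 1}| = |{g : G // g² = 1}|`**.

Used for class groups of imaginary quadratic fields (`G = Cl_K`, `|Cl_K[2]| = 2^{t−1}`,
`AmbiguousClasses.lean`) to see that the genus characters exhaust the real characters.

## References

* [Cox2013] D. A. Cox, *Primes of the form x² + ny²*, 2nd ed. (2013), §3.B (proof of Thm. 3.15: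
  "the number of genera equals the number of elements of order ≤ 2"). [folklore]
-/

noncomputable section

namespace Literature.NumberTheory.NumberFields

variable (G : Type*) [CommGroup G] [Finite G]

/-- **`|G ⧸ G²| = |G[2]|`** for a finite abelian group: the squaring endomorphism has kernel
`G[2] = {g : g² = 1}` and image `G²`, so `|G| = |G[2]|·|G²| = |G²|·|G/G²|`. [folklore] -/
theorem card_quotient_range_sq_eq_card_sq_eq_one :
    Nat.card (G ⧸ (powMonoidHom 2 : G →* G).range) = Nat.card {g : G // g ^ 2 = 1} := by
  set f : G →* G := powMonoidHom 2 with hf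
  have h1 : Nat.card G = Nat.card (G ⧸ f.ker) * Nat.card f.ker :=
    Subgroup.card_eq_card_quotient_mul_card_subgroup f.ker
  have h2 : Nat.card G = Nat.card (G ⧸ f.range) * Nat.card f.range :=
    Subgroup.card_eq_card_quotient_mul_card_subgroup f.range
  have h3 : Nat.card (G ⧸ f.ker) = Nat.card f.range :=
    Nat.card_congr (QuotientGroup.quotientKerEquivRange f).toEquiv
  have h4 : Nat.card f.ker = Nat.card {g : G // g ^ 2 = 1} :=
    Nat.card_congr (Equiv.subtypeEquivRight fun g ↦ by rw [MonoidHom.mem_ker, hf, powMonoidHom_apply])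
  have hpos : 0 < Nat.card f.range := Nat.card_pos
  rw [h3] at h1
  rw [← h4]
  have : Nat.card (G ⧸ f.range) * Nat.card f.range = Nat.card f.ker * Nat.card f.range := by
    rw [← h2, h1, mul_comm]
  exact Nat.eq_of_mul_eq_mul_right hpos this

/-- **The real characters of a finite abelian group number `|G[2]|`**:
`|{χ : G →* ℂˣ // χ·χ = 1}| = |{g : G // g² = 1}|` (duality: the characters trivial on `G²` are
the dual of `G/G²`, of cardinality `|G/G²| = |G[2]|`). [folklore] -/
theorem card_monoidHom_mul_self_eq_one :
    Nat.card {χ : G →* ℂˣ // χ * χ = 1} = Nat.card {g : G // g ^ 2 = 1} := by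
  set H : Subgroup G := (powMonoidHom 2 : G →* G).range with hH
  haveI : NeZero ((Monoid.exponent G : ℕ) : ℂ) :=
    ⟨Nat.cast_ne_zero.mpr Monoid.exponent_ne_zero_of_finite⟩
  have hdual := CommGroup.card_subgroupOrderIsoSubgroupMonoidHom (G := G) ℂ H
  rw [card_quotient_range_sq_eq_card_sq_eq_one] at hdual
  rw [← hdual]
  refine Nat.card_congr (Equiv.subtypeEquivRight fun χ ↦ ?_)
  rw [CommGroup.mem_subgroupOrderIsoSubgroupMonoidHom_iff]
  constructor
  · intro hχ g hg
    obtain ⟨x, rfl⟩ := hg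
    rw [powMonoidHom_apply, map_pow, sq, ← MonoidHom.mul_apply, hχ, MonoidHom.one_apply]
  · intro h
    ext x
    rw [MonoidHom.mul_apply, Units.val_mul, MonoidHom.one_apply, Units.val_one, ← Units.val_mul,
      ← sq, ← map_pow, h (x ^ 2) ⟨x, rfl⟩, Units.val_one]

end Literature.NumberTheory.NumberFields

end
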